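import Literature.Barriers.ResolutionOfSingularities.LocalMonomializationFailsLemma
import Literature.AlgebraicGeometry.Resolution.OriginTaylorTransport
import Literature.RingTheory.TwoVariableSeries.LeadingForm
import HarnessLib

/-!
# Cutkosky's Lemma 3.1: the structural form of the expansions (4), and conclusion (C1)

`Literature/Barriers/ResolutionOfSingularities/LocalMonomializationFailsLemmaShape.lean` — first
file of the discharge of the named fact
`Literature.Barriers.ResolutionOfSingularities.Cutkosky.CutkoskyLemma31` (Cutkosky, Math. Ann.
362 (2015), Lemma 3.1; `LocalMonomializationFailsLemma.lean`).

* **Decomposition** (`exists_decomp_of_lemmaShape`): the power-series hypothesis (4)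
  `u = xᵖ(c₀ + f₀y + xΛ₀)`, `v = τ₀(y)yᵖ + e₀x + xΩ₀` in `B̂ = F[[x,y]]` is converted into the
  RING-LEVEL statement `u = xᵖ·u₁`, `v = x·v₂ + yᵖ·v₃` with `u₁, v₂, v₃ ∈ B = F[x,y]_{(x,y)}`
  units of residues `c₀, e₀, τ̄₀`, and `coeff_y(T u₁) = f₀` (polynomial representatives and the
  monomial-ideal membership criterion of Mathlib).
* **Inclusions** `B ⊆ B_i` (`x = x_i y_iⁱ, y = y_i`, `i < p`) and `B ⊆ B_p`
  (`x = x_pᵖ(y_p + α), y = x_p`) with the Taylor expansions of `x, y` in `B̂_i`, `B̂_p`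
  (`le_Bi`, `le_Bp`).
* **(C1)** ("Thus no quadratic transform of `A` factors through `A → B_i`", `0 ≤ i < p`): if a
  quadratic transform `A'` of `A` lay inside `B_i` then, `𝔪_A A'` being principal, `T_i u ∣ T_i v`
  or `T_i v ∣ T_i u` in `F[[x_i,y_i]]`; but `T_i u = x_iᵖ y_i^{pi}·unit` and
  `T_i v = y_iⁱ(x_i E₂ + y_i^{p−i} E₃)` exclude both (kill a variable and cancel).
  [cite: Cutkosky2014, Lemma 3.1 (proof, first paragraph)]
-/

noncomputable section

namespace Literature.Barriers.ResolutionOfSingularities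

namespace Cutkosky

open Literature.AlgebraicGeometry.Resolution Literature.RingTheory.TwoVariableSeries IsLocalRing

universe u

variable {F : Type u} [Field F] {L : Type u} [Field L] [Algebra F L]

/-! ## From the expansions (4) to `u = xᵖ u₁`, `v = x v₂ + yᵖ v₃` -/

section Decomposition

variable {b : Fin 2 → L} (hb : AlgebraicIndependent F b)

/-- A polynomial with nonzero constant term is nonzero as a power series. [folklore] -/
theorem coe_ne_zero_of_constantCoeff_ne_zero {g : MvPolynomial (Fin 2) F} (hg : MvPolynomial.constantCoeff g ≠ 0) :
    (g : MvPowerSeries (Fin 2) F) ≠ 0 := fun h0 =>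
  hg (by rw [← constantCoeff_coe, h0, map_zero])

/-- The Taylor expansion times the denominator is the numerator: `T(f/g) · g = f`. [folklore] -/
theorem originTaylorAt_mul_coe (z : originLocalRing hb) (f g : MvPolynomial (Fin 2) F)
    (hg : MvPolynomial.constantCoeff g ≠ 0) (hz : (z : L) = MvPolynomial.aeval b f / MvPolynomial.aeval b g) :
    originTaylorAt hb z * (g : MvPowerSeries (Fin 2) F) = f := by
  rw [originTaylorAt_eq_of_eq_div hb z f g hg hz, mul_assoc,
    MvPowerSeries.inv_mul_cancel _ (by rwa [constantCoeff_coe]), mul_one]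

/-- **The `u`-half of the decomposition**: if `T u = xᵖ · W` in `B̂` then `u = xᵖ · u₁` with
`u₁ ∈ B` and `T u₁ = W`. [cite: Cutkosky2014, Lemma 3.1 (4)] -/
theorem exists_eq_X_pow_mul (p : ℕ) (u : originLocalRing hb) (W : MvPowerSeries (Fin 2) F)
    (hu : originTaylorAt hb u = MvPowerSeries.X 0 ^ p * W) :
    ∃ u₁ : originLocalRing hb, u = originCoord hb 0 ^ p * u₁ ∧ originTaylorAt hb u₁ = W := by
  classical
  haveI := isDomain_mvPowerSeries (F := F) (Fin 2)
  obtain ⟨fu, gu, hgu, hufg⟩ := (mem_originLocalRing_iff hb).mp u.2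
  have hfu : (fu : MvPowerSeries (Fin 2) F) = MvPowerSeries.X 0 ^ p * W * (gu : MvPowerSeries (Fin 2) F) := by
    rw [← originTaylorAt_mul_coe hb u fu gu hgu hufg, hu]
  -- every exponent of `fu` is divisible by `xᵖ`
  have hdvd : ∀ m ∈ fu.support, Finsupp.single (0 : Fin 2) p ≤ m := by
    intro m hm
    by_contra hlt
    rw [Finsupp.single_le_iff, not_le] at hlt
    have hX : (MvPowerSeries.X 0 : MvPowerSeries (Fin 2) F) ^ p ∣ (fu : MvPowerSeries (Fin 2) F) :=
      ⟨W * (gu : MvPowerSeries (Fin 2) F), by rw [hfu]; ring⟩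
    have h0 := (MvPowerSeries.X_pow_dvd_iff.mp hX) m hlt
    rw [MvPolynomial.coeff_coe] at h0
    exact (MvPolynomial.mem_support_iff.mp hm) h0
  have hmem : fu ∈ Ideal.span ((fun s => MvPolynomial.monomial s (1 : F)) '' {Finsupp.single 0 p}) := by
    rw [MvPolynomial.mem_ideal_span_monomial_image]
    exact fun m hm => ⟨_, rfl, hdvd m hm⟩
  rw [Set.image_singleton, Ideal.mem_span_singleton'] at hmem
  obtain ⟨fu', hfu'⟩ := hmem
  have hmon : MvPolynomial.monomial (Finsupp.single (0 : Fin 2) p) (1 : F) = MvPolynomial.X 0 ^ p :=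
    (MvPolynomial.X_pow_eq_monomial).symm
  rw [hmon] at hfu'
  -- `u₁ := fu'(b) / gu(b)`
  have hu₁mem : MvPolynomial.aeval b fu' / MvPolynomial.aeval b gu ∈ originLocalRing hb :=
    (mem_originLocalRing_iff hb).mpr ⟨fu', gu, hgu, rfl⟩
  refine ⟨⟨_, hu₁mem⟩, Subtype.ext ?_, ?_⟩
  · change (u : L) = b 0 ^ p * (MvPolynomial.aeval b fu' / MvPolynomial.aeval b gu)
    rw [hufg, ← hfu', map_mul, map_pow, MvPolynomial.aeval_X]
    ring
  · have h1 : (MvPowerSeries.X 0 : MvPowerSeries (Fin 2) F) ^ p *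
        (originTaylorAt hb ⟨_, hu₁mem⟩ * (gu : MvPowerSeries (Fin 2) F)) =
        MvPowerSeries.X 0 ^ p * (W * (gu : MvPowerSeries (Fin 2) F)) := by
      rw [originTaylorAt_mul_coe hb ⟨_, hu₁mem⟩ fu' gu hgu rfl, ← mul_assoc, ← hfu, ← hfu',
        MvPolynomial.coe_mul, MvPolynomial.coe_pow, MvPolynomial.coe_X, mul_comm]
    exact mul_right_cancel₀ (coe_ne_zero_of_constantCoeff_ne_zero hgu)
      (mul_left_cancel₀ (pow_ne_zero _ (X_ne_zero' 0)) h1)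

/-- **The `v`-half of the decomposition**: if `T v = τ₀ yᵖ + e₀ x + x Ω₀` in `B̂` with
`Ω₀(0) = 0` then `v = x v₂ + yᵖ v₃` with `v₂, v₃ ∈ B` of residues `e₀`, `τ₀(0)` (the hypothesis
`τ₀ ∈ F[[y]]` of (4) is not even needed for this).
[cite: Cutkosky2014, Lemma 3.1 (4)] -/
theorem exists_eq_X_mul_add_Y_pow_mul {p : ℕ} (hp : p ≠ 0) (v : originLocalRing hb) (e₀ : F)
    (τ₀ Ω : MvPowerSeries (Fin 2) F) (hΩ : MvPowerSeries.constantCoeff Ω = 0)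
    (hv : originTaylorAt hb v =
      τ₀ * MvPowerSeries.X 1 ^ p + MvPowerSeries.C e₀ * MvPowerSeries.X 0 + MvPowerSeries.X 0 * Ω) :
    ∃ v₂ v₃ : originLocalRing hb, v = originCoord hb 0 * v₂ + originCoord hb 1 ^ p * v₃ ∧
      MvPowerSeries.constantCoeff (originTaylorAt hb v₂) = e₀ ∧
      MvPowerSeries.constantCoeff (originTaylorAt hb v₃) = MvPowerSeries.constantCoeff τ₀ := by
  classical
  obtain ⟨fv, gv, hgv, hvfg⟩ := (mem_originLocalRing_iff hb).mp v.2
  set V := τ₀ * MvPowerSeries.X 1 ^ p + MvPowerSeries.C e₀ * MvPowerSeries.X 0 + MvPowerSeries.X 0 * Ω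
    with hV
  have hfv : (fv : MvPowerSeries (Fin 2) F) = V * (gv : MvPowerSeries (Fin 2) F) := by
    rw [← originTaylorAt_mul_coe hb v fv gv hgv hvfg, hv]
  -- restriction of `V` to the axis `x = 0`
  have hκV : killVar 0 V = killVar 0 τ₀ * PowerSeries.X ^ p := by
    rw [hV, map_add, map_add, map_mul, killVar_zero_X_one_pow, map_mul, map_mul, killVar_X_self,
      mul_zero, add_zero, zero_mul, add_zero]
  -- every exponent of `fv` is divisible by `x` or by `yᵖ`
  have hsupp : ∀ m ∈ fv.support, Finsupp.single (0 : Fin 2) 1 ≤ m ∨ Finsupp.single (1 : Fin 2) p ≤ m := by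
    intro m hm
    by_contra hnot
    rw [not_or, Finsupp.single_le_iff, Finsupp.single_le_iff, not_le, not_le] at hnot
    have hm0 : m 0 = 0 := by omega
    have key : MvPowerSeries.coeff m (fv : MvPowerSeries (Fin 2) F) = 0 := by
      rw [finsupp_eq_single_of_rev_eq_zero (j := 1) hm0, ← coeff_killVar_zero, hfv, map_mul, hκV, mul_assoc,
        mul_comm (PowerSeries.X ^ p), ← mul_assoc, PowerSeries.coeff_mul_X_pow', if_neg (not_le.mpr hnot.2)]
    rw [MvPolynomial.coeff_coe] at key
    exact (MvPolynomial.mem_support_iff.mp hm) key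
  have hmem : fv ∈ Ideal.span ((fun s => MvPolynomial.monomial s (1 : F)) ''
      {Finsupp.single 0 1, Finsupp.single 1 p}) := by
    rw [MvPolynomial.mem_ideal_span_monomial_image]
    intro m hm
    rcases hsupp m hm with h | h
    · exact ⟨_, Set.mem_insert _ _, h⟩
    · exact ⟨_, Set.mem_insert_of_mem _ rfl, h⟩
  rw [Set.image_insert_eq, Set.image_singleton, Ideal.mem_span_pair] at hmem
  obtain ⟨A, B', hAB⟩ := hmem
  have hX0 : MvPolynomial.monomial (Finsupp.single (0 : Fin 2) 1) (1 : F) = MvPolynomial.X 0 := by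
    rw [MvPolynomial.X, MvPolynomial.monomial]
  have hX1 : MvPolynomial.monomial (Finsupp.single (1 : Fin 2) p) (1 : F) = MvPolynomial.X 1 ^ p :=
    (MvPolynomial.X_pow_eq_monomial).symm
  rw [hX0, hX1] at hAB
  -- the two fractions
  have hv₂mem : MvPolynomial.aeval b A / MvPolynomial.aeval b gv ∈ originLocalRing hb :=
    (mem_originLocalRing_iff hb).mpr ⟨A, gv, hgv, rfl⟩
  have hv₃mem : MvPolynomial.aeval b B' / MvPolynomial.aeval b gv ∈ originLocalRing hb :=
    (mem_originLocalRing_iff hb).mpr ⟨B', gv, hgv, rfl⟩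
  -- the identity `A x + B' yᵖ = V g` in `B̂`
  have hABs : (A : MvPowerSeries (Fin 2) F) * MvPowerSeries.X 0 + (B' : MvPowerSeries (Fin 2) F) * MvPowerSeries.X 1 ^ p =
      V * (gv : MvPowerSeries (Fin 2) F) := by
    rw [← hfv, ← hAB, MvPolynomial.coe_add, MvPolynomial.coe_mul, MvPolynomial.coe_mul, MvPolynomial.coe_X,
      MvPolynomial.coe_pow, MvPolynomial.coe_X]
  have hV0 : MvPowerSeries.constantCoeff V = 0 := by
    rw [hV, map_add, map_add, map_mul, map_mul, map_mul, constantCoeff_X_pow hp, MvPowerSeries.constantCoeff_X,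
      mul_zero, mul_zero, zero_mul, add_zero, add_zero]
  -- (a) the coefficient of `x`: `A(0) = e₀ g(0)`
  have hA0 : MvPolynomial.constantCoeff A = e₀ * MvPolynomial.constantCoeff gv := by
    have h := congrArg (MvPowerSeries.coeff (Finsupp.single 0 1)) hABs
    rw [map_add, mul_comm (A : MvPowerSeries (Fin 2) F), mul_comm (B' : MvPowerSeries (Fin 2) F),
      coeff_single_one_X_mul, coeff_single_zero_one_X_one_pow_mul hp, add_zero, constantCoeff_coe,
      coeff_single_one_mul, hV0, zero_mul, zero_add, constantCoeff_coe, hV, map_add, map_add,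
      mul_comm τ₀, coeff_single_zero_one_X_one_pow_mul hp, zero_add, MvPowerSeries.coeff_C_mul,
      coeff_single_one_X_self, mul_one, coeff_single_one_X_mul, hΩ, add_zero] at h
    exact h
  -- (b) the restriction to `x = 0`: `B'(0) = τ̄₀ g(0)`
  have hB0 : MvPolynomial.constantCoeff B' = MvPowerSeries.constantCoeff τ₀ * MvPolynomial.constantCoeff gv := by
    have h := congrArg (killVar 0) hABs
    rw [map_add, map_mul, map_mul, killVar_X_self, mul_zero, zero_add, killVar_zero_X_one_pow, map_mul, hκV,
      mul_assoc, mul_comm (PowerSeries.X ^ p), ← mul_assoc] at h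
    have h' := mul_right_cancel₀ (pow_ne_zero _ PowerSeries.X_ne_zero) h
    have h'' := congrArg PowerSeries.constantCoeff h'
    rwa [map_mul, constantCoeff_killVar, constantCoeff_killVar, constantCoeff_killVar, constantCoeff_coe,
      constantCoeff_coe] at h''
  refine ⟨⟨_, hv₂mem⟩, ⟨_, hv₃mem⟩, Subtype.ext ?_, ?_, ?_⟩
  · change (v : L) = b 0 * (MvPolynomial.aeval b A / MvPolynomial.aeval b gv) +
      b 1 ^ p * (MvPolynomial.aeval b B' / MvPolynomial.aeval b gv)
    rw [hvfg, ← hAB, map_add, map_mul, map_mul, map_pow, MvPolynomial.aeval_X, MvPolynomial.aeval_X]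
    ring
  · rw [constantCoeff_originTaylorAt_of_eq_div hb ⟨_, hv₂mem⟩ A gv hgv rfl, hA0, mul_div_assoc,
      div_self hgv, mul_one]
  · rw [constantCoeff_originTaylorAt_of_eq_div hb ⟨_, hv₃mem⟩ B' gv hgv rfl, hB0, mul_div_assoc,
      div_self hgv, mul_one]

/-- **Decomposition of the expansions (4)**: from `LemmaShape p hb u v c₀ f₀ e₀ τ₀` (Cutkosky's
(4) in `B̂ = F[[x,y]]`) one gets `u₁, v₂, v₃ ∈ B = F[x,y]_{(x,y)}` with `u = xᵖ u₁`,
`v = x v₂ + yᵖ v₃`, residues `u₁(0) = c₀`, `v₂(0) = e₀`, `v₃(0) = τ̄₀` (all nonzero, so these are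
units of `B`) and `coeff_y(T u₁) = f₀`. [cite: Cutkosky2014, Lemma 3.1 (4)] -/
theorem exists_decomp_of_lemmaShape {p : ℕ} (hp : p ≠ 0) {u v : originLocalRing hb} {c₀ f₀ e₀ : F}
    {τ₀ : MvPowerSeries (Fin 2) F} (h : LemmaShape p hb u v c₀ f₀ e₀ τ₀) :
    ∃ u₁ v₂ v₃ : originLocalRing hb,
      u = originCoord hb 0 ^ p * u₁ ∧ v = originCoord hb 0 * v₂ + originCoord hb 1 ^ p * v₃ ∧
      MvPowerSeries.constantCoeff (originTaylorAt hb u₁) = c₀ ∧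
      MvPowerSeries.coeff (Finsupp.single 1 1) (originTaylorAt hb u₁) = f₀ ∧
      MvPowerSeries.constantCoeff (originTaylorAt hb v₂) = e₀ ∧
      MvPowerSeries.constantCoeff (originTaylorAt hb v₃) = MvPowerSeries.constantCoeff τ₀ := by
  obtain ⟨-, -, -, -, -, ⟨Λ, hu⟩, ⟨Ω, hΩ0, hv⟩⟩ := h
  obtain ⟨u₁, hu₁, hTu₁⟩ := exists_eq_X_pow_mul hb p u _ hu
  obtain ⟨v₂, v₃, hv₂₃, hv₂, hv₃⟩ := exists_eq_X_mul_add_Y_pow_mul hb hp v e₀ τ₀ Ω hΩ0 hv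
  refine ⟨u₁, v₂, v₃, hu₁, hv₂₃, ?_, ?_, hv₂, hv₃⟩
  · rw [hTu₁, map_add, map_add, map_mul, map_mul, MvPowerSeries.constantCoeff_C, MvPowerSeries.constantCoeff_C,
      MvPowerSeries.constantCoeff_X, MvPowerSeries.constantCoeff_X, mul_zero, zero_mul, add_zero, add_zero]
  · rw [hTu₁, map_add, map_add, coeff_single_one_C, MvPowerSeries.coeff_C_mul, coeff_single_one_X_self,
      coeff_single_one_one_X_zero_mul, zero_add, mul_one, add_zero]

end Decomposition

/-! ## The inclusions `B ⊆ B_i` (`i < p`) and `B ⊆ B_p` with Taylor expansions of `x, y` -/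

section Inclusions

variable (p : ℕ) {b : Fin 2 → L} (hb : AlgebraicIndependent F b) (α : F)

/-- **`B ⊆ B_i` for `i < p`** (`x = x_i y_iⁱ`, `y = y_i`): inclusion, `x, y ∈ 𝔪_{B_i}`, and the
expansions `T_i x = X·Yⁱ`, `T_i y = Y` in `B̂_i`. [cite: Cutkosky2014, Lemma 3.1] -/
theorem le_Bi {i : ℕ} (hi : i < p) (hB : AlgebraicIndependent F (bCoord F L p (b 0) (b 1) α i)) :
    ∃ hle : originLocalRing hb ≤ originLocalRing hB,
      (∀ j, haveI := isLocalRing_originLocalRing hB;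
        (⟨b j, hle (mem_originLocalRing_self hb j)⟩ : originLocalRing hB) ∈ maximalIdeal (originLocalRing hB)) ∧
      originTaylorAt hB ⟨b 0, hle (mem_originLocalRing_self hb 0)⟩ = MvPowerSeries.X 0 * MvPowerSeries.X 1 ^ i ∧
      originTaylorAt hB ⟨b 1, hle (mem_originLocalRing_self hb 1)⟩ = MvPowerSeries.X 1 := by
  have hy : b 1 ≠ 0 := by simpa using hb.ne_zero 1
  obtain ⟨hle, hmax, hT⟩ := le_and_originTaylorAt_eq_of_eq_aeval hb hB ![MvPolynomial.X 0 * MvPolynomial.X 1 ^ i, MvPolynomial.X 1]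
    (fun j => by fin_cases j <;> simp [MvPolynomial.constantCoeff_X])
    (fun j => by
      fin_cases j
      · simp only [Fin.zero_eta, Matrix.cons_val_zero, map_mul, map_pow, MvPolynomial.aeval_X]
        exact ((bCoord_subst_of_lt (F := F) (b 0) (b 1) hy α hi).1).symm
      · simp only [Fin.mk_one, Matrix.cons_val_one, MvPolynomial.aeval_X, Matrix.cons_val_zero]
        exact ((bCoord_subst_of_lt (F := F) (b 0) (b 1) hy α hi).2).symm)
  refine ⟨hle, hmax, ?_, ?_⟩
  · rw [hT 0]
    simp
  · rw [hT 1]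
    simp

/-- **`B ⊆ B_p`** (`x = x_pᵖ(y_p + α)`, `y = x_p`): inclusion, `x, y ∈ 𝔪_{B_p}`, and the expansions
`T_p x = Xᵖ(Y + α)`, `T_p y = X` in `B̂_p`. [cite: Cutkosky2014, Lemma 3.1] -/
theorem le_Bp (hp0 : p ≠ 0) (hB : AlgebraicIndependent F (bCoord F L p (b 0) (b 1) α p)) :
    ∃ hle : originLocalRing hb ≤ originLocalRing hB,
      (∀ j, haveI := isLocalRing_originLocalRing hB;
        (⟨b j, hle (mem_originLocalRing_self hb j)⟩ : originLocalRing hB) ∈ maximalIdeal (originLocalRing hB)) ∧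
      originTaylorAt hB ⟨b 0, hle (mem_originLocalRing_self hb 0)⟩ =
        MvPowerSeries.X 0 ^ p * (MvPowerSeries.X 1 + MvPowerSeries.C α) ∧
      originTaylorAt hB ⟨b 1, hle (mem_originLocalRing_self hb 1)⟩ = MvPowerSeries.X 0 := by
  have hy : b 1 ≠ 0 := by simpa using hb.ne_zero 1
  obtain ⟨hle, hmax, hT⟩ := le_and_originTaylorAt_eq_of_eq_aeval hb hB
    ![MvPolynomial.X 0 ^ p * (MvPolynomial.X 1 + MvPolynomial.C α), MvPolynomial.X 0]
    (fun j => by fin_cases j <;> simp [MvPolynomial.constantCoeff_X, hp0])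
    (fun j => by
      fin_cases j
      · simp only [Fin.zero_eta, Matrix.cons_val_zero, map_mul, map_pow, MvPolynomial.aeval_X, map_add,
          MvPolynomial.aeval_C]
        exact ((bCoord_subst_self (F := F) p (b 0) (b 1) hy α).1).symm
      · simp only [Fin.mk_one, Matrix.cons_val_one, MvPolynomial.aeval_X, Matrix.cons_val_zero]
        exact ((bCoord_subst_self (F := F) p (b 0) (b 1) hy α).2).symm)
  refine ⟨hle, hmax, ?_, ?_⟩
  · rw [hT 0]
    simp only [Matrix.cons_val_zero, MvPolynomial.coe_mul, MvPolynomial.coe_pow, MvPolynomial.coe_X,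
      MvPolynomial.coe_add, MvPolynomial.coe_C]
  · rw [hT 1]
    simp

end Inclusions

/-! ## (C1): no quadratic transform of `A` lies in `B_i`, `0 ≤ i < p` -/

section C1

/-- **The power-series heart of (C1)**: in `F[[X,Y]]`, with units `U₁, E₂, E₃` and `0 ≤ i < p`,
neither of `U = Xᵖ Y^{pi} U₁` and `V = Yⁱ (X E₂ + Y^{p−i} E₃)` divides the other.
[cite: Cutkosky2014, Lemma 3.1 (proof, "Thus no quadratic transform of `A` factors through `A → B_i`")] -/
theorem not_dvd_and_not_dvd {p i : ℕ} (hip : i < p) {U₁ E₂ E₃ : MvPowerSeries (Fin 2) F}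
    (hU₁ : MvPowerSeries.constantCoeff U₁ ≠ 0) (hE₂ : MvPowerSeries.constantCoeff E₂ ≠ 0)
    (hE₃ : MvPowerSeries.constantCoeff E₃ ≠ 0) :
    ¬ (MvPowerSeries.X 0 ^ p * MvPowerSeries.X 1 ^ (p * i) * U₁ ∣
        MvPowerSeries.X 1 ^ i * (MvPowerSeries.X 0 * E₂ + MvPowerSeries.X 1 ^ (p - i) * E₃)) ∧
    ¬ (MvPowerSeries.X 1 ^ i * (MvPowerSeries.X 0 * E₂ + MvPowerSeries.X 1 ^ (p - i) * E₃) ∣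
        MvPowerSeries.X 0 ^ p * MvPowerSeries.X 1 ^ (p * i) * U₁) := by
  have hp : p ≠ 0 := by omega
  have hpi : p - i ≠ 0 := by omega
  set w := MvPowerSeries.X 0 * E₂ + MvPowerSeries.X 1 ^ (p - i) * E₃ with hw
  have hκ0w : killVar 0 w = PowerSeries.X ^ (p - i) * killVar 0 E₃ := by
    rw [hw, map_add, map_mul, map_mul, killVar_X_self, zero_mul, zero_add, killVar_zero_X_one_pow]
  have hκ1w : killVar 1 w = PowerSeries.X * killVar 1 E₂ := by
    rw [hw, map_add, map_mul, map_mul, killVar_one_X_zero, map_pow, killVar_X_self, zero_pow hpi, zero_mul,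
      add_zero]
  have hκE₃ : killVar 0 E₃ ≠ 0 := fun h0 => hE₃ (by rw [← constantCoeff_killVar 0, h0, map_zero])
  have hκE₂ : killVar 1 E₂ ≠ 0 := fun h0 => hE₂ (by rw [← constantCoeff_killVar 1, h0, map_zero])
  have hκ0w_ne : killVar 0 w ≠ 0 := by
    rw [hκ0w]; exact mul_ne_zero (pow_ne_zero _ PowerSeries.X_ne_zero) hκE₃
  have hκ1w_ne : killVar 1 w ≠ 0 := by
    rw [hκ1w]; exact mul_ne_zero PowerSeries.X_ne_zero hκE₂
  have hw0 : MvPowerSeries.constantCoeff w = 0 := by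
    rw [hw, map_add, map_mul, map_mul, MvPowerSeries.constantCoeff_X, constantCoeff_X_pow hpi, zero_mul,
      zero_mul, add_zero]
  constructor
  · -- `X ∣ Yⁱ w` is impossible: kill `X`
    rintro ⟨q, hq⟩
    have h := congrArg (killVar 0) hq
    rw [map_mul, killVar_zero_X_one_pow, hκ0w, map_mul, map_mul, map_mul, map_pow, killVar_X_self,
      zero_pow hp, zero_mul, zero_mul, zero_mul] at h
    exact mul_ne_zero (pow_ne_zero _ PowerSeries.X_ne_zero) (mul_ne_zero (pow_ne_zero _ PowerSeries.X_ne_zero) hκE₃) h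
  · -- `w ∣ Xᵖ Y^{pi} U₁` is impossible: cancel the variables
    intro h
    have hw_dvd : w ∣ MvPowerSeries.X 0 ^ p * MvPowerSeries.X 1 ^ (p * i) * U₁ :=
      (dvd_mul_left w _).trans h
    exact not_dvd_X_pow_mul_X_pow_mul hw0 hκ0w_ne hκ1w_ne (isUnit_of_constantCoeff_ne_zero hU₁) p (p * i) hw_dvd

variable (p : ℕ) [hp : Fact p.Prime] {a b : Fin 2 → L} (ha : AlgebraicIndependent F a) (hb : AlgebraicIndependent F b)
  (hAB : originLocalRing ha ≤ originLocalRing hb)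

/-- **(C1) of Lemma 3.1**: for `0 ≤ i < p`, no quadratic transform `A'` of `A = F[u,v]_{(u,v)}`
is contained in `B_i = F[x_i,y_i]_{(x_i,y_i)}` (in particular none is dominated by `B_i`):
otherwise `𝔪_A B_i` would be generated by one element `z` of `𝔪_A`, forcing `T_i u ∣ T_i v` or
`T_i v ∣ T_i u` in `B̂_i`, excluded by `not_dvd_and_not_dvd`.
[cite: Cutkosky2014, Lemma 3.1 ("`B_i` does not dominate any quadratic transform of `A` for `0 ≤ i < p`")] -/
theorem lemma31_C1 {c₀ f₀ e₀ : F} {τ₀ : MvPowerSeries (Fin 2) F}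
    (hshape : LemmaShape p hb ⟨a 0, hAB (mem_originLocalRing_self ha 0)⟩
      ⟨a 1, hAB (mem_originLocalRing_self ha 1)⟩ c₀ f₀ e₀ τ₀)
    (α : F) {i : ℕ} (hi : i < p) (hB : AlgebraicIndependent F (bCoord F L p (b 0) (b 1) α i))
    (A' : Subring L) (hqt : IsQuadraticTransform (originLocalRing ha).toSubring A')
    (hA'B : A' ≤ (originLocalRing hB).toSubring) : False := by
  classical
  haveI := isDomain_mvPowerSeries (F := F) (Fin 2)
  haveI := isLocalRing_originLocalRing ha
  have hp0 : p ≠ 0 := hp.out.ne_zero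
  obtain ⟨u₁, v₂, v₃, hu, hv, hu₁, -, hv₂, hv₃⟩ := exists_decomp_of_lemmaShape hb hp0 hshape
  obtain ⟨hc, hf, he, hτY, hτ0, -, -⟩ := hshape
  obtain ⟨hle, hmax, hTx, hTy⟩ := le_Bi p hb α hi hB
  -- the generator `z` of `𝔪_A A'` (the data of the quadratic transform live on the subring
  -- `A.toSubring`; we convert them to statements about the subalgebra `A` through `L`)
  obtain ⟨hlocR, z, hzmax, hz0, -, hblow, -, -⟩ := hqt
  have hzval : (z : L) ≠ 0 := fun e => hz0 (Subtype.ext e)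
  have hzinv : (z : L)⁻¹ ∉ originLocalRing ha :=
    ((mem_maximalIdeal_iff_inv_not_mem z).mp hzmax).resolve_left hzval
  have hamax : ∀ j : Fin 2,
      (⟨a j, mem_originLocalRing_self ha j⟩ : (originLocalRing ha).toSubring) ∈ @maximalIdeal _ _ hlocR := by
    intro j
    rw [mem_maximalIdeal_iff_inv_not_mem]
    refine Or.inr fun hinv => ?_
    have hne : a j ≠ 0 := ha.ne_zero j
    have hunit : IsUnit (originCoord ha j) :=
      ⟨⟨originCoord ha j, ⟨(a j)⁻¹, hinv⟩, Subtype.ext (mul_inv_cancel₀ hne), Subtype.ext (inv_mul_cancel₀ hne)⟩, rfl⟩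
    exact (IsLocalRing.mem_maximalIdeal _).mp (originCoord_mem_maximalIdeal ha j) hunit
  have hzA : (⟨z, z.2⟩ : originLocalRing ha) ∈ maximalIdeal (originLocalRing ha) := by
    rw [IsLocalRing.mem_maximalIdeal, mem_nonunits_iff]
    rintro ⟨w, hw⟩
    apply hzinv
    have e : (z : L)⁻¹ = ((↑w⁻¹ : originLocalRing ha) : L) := by
      rw [coe_units_inv_subalgebra, hw]
    rw [e]
    exact Subtype.mem _
  have hzspan : (⟨z, z.2⟩ : originLocalRing ha) ∈ Ideal.span (Set.range (originCoord ha)) := by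
    rwa [← maximalIdeal_originLocalRing ha]
  obtain ⟨c, hcz⟩ := Ideal.mem_span_range_iff_exists_fun.mp hzspan
  -- `u/z, v/z ∈ A' ⊆ B_i`
  have hdiv : ∀ j : Fin 2, (a j) / (z : L) ∈ originLocalRing hB := fun j =>
    hA'B (hblow (div_mem_blowupRing (z : L) (hamax j)))
  have hAB' : originLocalRing ha ≤ originLocalRing hB := hAB.trans hle
  -- the elements of `B_i` in play
  have hzmem : (z : L) ∈ originLocalRing hB := hAB' z.2
  have humem : a 0 ∈ originLocalRing hB := hAB' (mem_originLocalRing_self ha 0)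
  have hvmem : a 1 ∈ originLocalRing hB := hAB' (mem_originLocalRing_self ha 1)
  have hc0mem : ((c 0 : originLocalRing ha) : L) ∈ originLocalRing hB := hAB' (c 0).2
  have hc1mem : ((c 1 : originLocalRing ha) : L) ∈ originLocalRing hB := hAB' (c 1).2
  have huB : (⟨a 0, humem⟩ : originLocalRing hB) = ⟨z, hzmem⟩ * ⟨a 0 / z, hdiv 0⟩ :=
    Subtype.ext (by change a 0 = z * (a 0 / z); rw [mul_div_cancel₀ _ hzval])
  have hvB : (⟨a 1, hvmem⟩ : originLocalRing hB) = ⟨z, hzmem⟩ * ⟨a 1 / z, hdiv 1⟩ :=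
    Subtype.ext (by change a 1 = z * (a 1 / z); rw [mul_div_cancel₀ _ hzval])
  have hzB : (⟨z, hzmem⟩ : originLocalRing hB) = ⟨_, hc0mem⟩ * ⟨a 0, humem⟩ + ⟨_, hc1mem⟩ * ⟨a 1, hvmem⟩ := by
    apply Subtype.ext
    have h := congrArg (fun w : originLocalRing ha => (w : L)) hcz
    simp only [Fin.sum_univ_two, Subalgebra.coe_add, Subalgebra.coe_mul, coe_originCoord] at h
    exact h.symm
  -- one of `T (u/z)`, `T (v/z)` is a unit
  have hunit : IsUnit (originTaylorAt hB ⟨a 0 / z, hdiv 0⟩) ∨ IsUnit (originTaylorAt hB ⟨a 1 / z, hdiv 1⟩) := by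
    have key : originTaylorAt hB ⟨z, hzmem⟩ *
        (1 - (originTaylorAt hB ⟨_, hc0mem⟩ * originTaylorAt hB ⟨a 0 / z, hdiv 0⟩ +
          originTaylorAt hB ⟨_, hc1mem⟩ * originTaylorAt hB ⟨a 1 / z, hdiv 1⟩)) = 0 := by
      have h := congrArg (originTaylorAt hB) hzB
      rw [map_add, map_mul, map_mul, huB, hvB, map_mul, map_mul] at h
      linear_combination h
    have hTz : originTaylorAt hB ⟨z, hzmem⟩ ≠ 0 := fun e =>
      hzval (congrArg Subtype.val (originTaylorAt_injective hB (e.trans (map_zero _).symm)))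
    have h1 := (mul_eq_zero.mp key).resolve_left hTz
    rw [sub_eq_zero] at h1
    have h2 := congrArg MvPowerSeries.constantCoeff h1
    rw [map_one, map_add, map_mul, map_mul] at h2
    by_contra hnot
    rw [not_or, MvPowerSeries.isUnit_iff_constantCoeff, MvPowerSeries.isUnit_iff_constantCoeff, isUnit_iff_ne_zero,
      isUnit_iff_ne_zero, not_not, not_not] at hnot
    rw [hnot.1, hnot.2, mul_zero, mul_zero, add_zero] at h2
    exact one_ne_zero h2
  -- the expansions of `u`, `v` in `B̂_i`
  have hTu : originTaylorAt hB ⟨a 0, humem⟩ =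
      MvPowerSeries.X 0 ^ p * MvPowerSeries.X 1 ^ (p * i) * originTaylorAt hB (Subalgebra.inclusion hle u₁) := by
    have e : (⟨a 0, humem⟩ : originLocalRing hB) = Subalgebra.inclusion hle ⟨a 0, hAB (mem_originLocalRing_self ha 0)⟩ := rfl
    have hxB : Subalgebra.inclusion hle (originCoord hb 0) = ⟨b 0, hle (mem_originLocalRing_self hb 0)⟩ := rfl
    rw [e, hu, map_mul, map_pow, map_mul, map_pow, hxB, hTx, mul_pow, ← pow_mul, mul_comm i p]
  have hTv : originTaylorAt hB ⟨a 1, hvmem⟩ =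
      MvPowerSeries.X 1 ^ i * (MvPowerSeries.X 0 * originTaylorAt hB (Subalgebra.inclusion hle v₂) +
        MvPowerSeries.X 1 ^ (p - i) * originTaylorAt hB (Subalgebra.inclusion hle v₃)) := by
    have e : (⟨a 1, hvmem⟩ : originLocalRing hB) = Subalgebra.inclusion hle ⟨a 1, hAB (mem_originLocalRing_self ha 1)⟩ := rfl
    have hxB : Subalgebra.inclusion hle (originCoord hb 0) = ⟨b 0, hle (mem_originLocalRing_self hb 0)⟩ := rfl
    have hyB : Subalgebra.inclusion hle (originCoord hb 1) = ⟨b 1, hle (mem_originLocalRing_self hb 1)⟩ := rfl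
    rw [e, hv]
    simp only [map_add, map_mul, map_pow]
    rw [hxB, hyB, hTx, hTy]
    have hsplit : (MvPowerSeries.X 1 : MvPowerSeries (Fin 2) F) ^ p = MvPowerSeries.X 1 ^ i * MvPowerSeries.X 1 ^ (p - i) := by
      rw [← pow_add, Nat.add_sub_cancel' hi.le]
    rw [hsplit]
    ring
  -- residues of the transported units
  have hres : ∀ w : originLocalRing hb, MvPowerSeries.constantCoeff (originTaylorAt hB (Subalgebra.inclusion hle w)) =
      MvPowerSeries.constantCoeff (originTaylorAt hb w) := fun w =>
    constantCoeff_originTaylorAt_inclusion hb hB hle hmax w.2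
  have hU₁ : MvPowerSeries.constantCoeff (originTaylorAt hB (Subalgebra.inclusion hle u₁)) ≠ 0 := by
    rw [hres, hu₁]; exact hc
  have hE₂ : MvPowerSeries.constantCoeff (originTaylorAt hB (Subalgebra.inclusion hle v₂)) ≠ 0 := by
    rw [hres, hv₂]; exact he
  have hE₃ : MvPowerSeries.constantCoeff (originTaylorAt hB (Subalgebra.inclusion hle v₃)) ≠ 0 := by
    rw [hres, hv₃]; exact hτ0
  obtain ⟨hnd₁, hnd₂⟩ := not_dvd_and_not_dvd (F := F) hi hU₁ hE₂ hE₃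
  rw [← hTu, ← hTv] at hnd₁ hnd₂
  rcases hunit with ⟨w, hw⟩ | ⟨w, hw⟩
  · apply hnd₁
    refine ⟨↑w⁻¹ * originTaylorAt hB ⟨a 1 / z, hdiv 1⟩, ?_⟩
    rw [hvB, map_mul, huB, map_mul, ← hw, mul_assoc, Units.mul_inv_cancel_left]
  · apply hnd₂
    refine ⟨↑w⁻¹ * originTaylorAt hB ⟨a 0 / z, hdiv 0⟩, ?_⟩
    rw [huB, map_mul, hvB, map_mul, ← hw, mul_assoc, Units.mul_inv_cancel_left]

end C1

end Cutkosky

end Literature.Barriers.ResolutionOfSingularities
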